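import Literature.NumberTheory.Sieve.ChenWeightedSieve
import Literature.NumberTheory.Sieve.ChenTheorem
import HarnessLib

/-!
# Chen's theorem: discharge of the weighted-sieve inequality (Nathanson, Theorem 10.2)

`Literature.NumberTheory.Sieve.ChenTheorem` vendors Nathanson's Theorem 10.2 as the named fact
`Literature.NumberTheory.Sieve.Chen.chen_weighted_sieve_inequality`: for every even `N ≥ 4⁸`, with
`z = N^{1/8}`, `y = N^{1/3}`,

  `r(N) > S(A, 𝒫, z) − ½ ∑_{z ≤ q < y} S(A_q, 𝒫, z) − ½ S(B, 𝒫, y) − 2N^{7/8} − N^{1/3}`.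

This file PROVES it (`chen_weighted_sieve_inequality_holds`), by specialising the abstract
weighted-sieve inequality `Literature.NumberTheory.Sieve.ChenSieve.weightedSieve` of
`Literature.NumberTheory.Sieve.ChenWeightedSieve` (the pointwise weight argument of Nathanson
§10.2, held copy pp. 167–169) to Nathanson's Goldbach sequence
`A = {N − p : p ≤ N, p prime, p ∤ N}` ((10.6)) with the integer parameters `⌈N^{1/8}⌉`, `⌈N^{1/3}⌉`.
No new definitions: the lemmas are stated for any finite set `A` with Nathanson's membership
condition `n ∈ A ↔ ∃ p prime, p ∤ N, p + n = N`, and the pairs `(p, N − p)` are the elements of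
`antidiagonal N` with `p` prime, `p ∤ N`, exactly as in the definitions of `siftedCount`,
`siftedCountDvd`, `repCount` in `ChenTheorem`.

## The bridge (Nathanson §10.2, held copy pp. 168–169)

* For `p + n = N`, `p` prime, `p ∤ N`: `n ≠ 0`, `n < N`, and `(n, N) = 1` (`not_dvd_of_goldbach`:
  a prime dividing `n` and `N` divides `p`). Hence Nathanson's sifting condition "no prime `q < w`,
  `q ∤ N`, divides `n`" is "every prime factor of `n` is `≥ w`" (`sift_iff_isRough`).
* Counting in `A` is counting pairs (`card_filter_eq_of_goldbach`), so
  `S(A, 𝒫, z) = roughCount A ⌈z⌉` (`siftedCount_eq_roughCount`),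
  `S(A_q, 𝒫, z) = roughMultCount A ⌈z⌉ q` (`siftedCountDvd_eq_roughMultCount`),
  `{q prime : z ≤ q < y} = primesIco ⌈z⌉ ⌈y⌉` (`midPrimes_eq_primesIco`), and
  `#{n ∈ A : Ω(n) ≤ 2} ≤ r(N)` (`almostPrimeTwoCount_le_repCount`; `p ∤ N`, `N` even ⇒ `p` odd).
* The third weight (held copy p. 169): an element `n = p₁p₂p₃ ∈ A`, `z ≤ p₁ < y ≤ p₂ ≤ p₃`, is
  `N − p` with `p` prime; either `p < y` (fewer than `⌈y⌉` of them) or `p ≥ y`, in which case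
  `p ∈ B` and `p` has no prime factor `< y`: `T ≤ ⌈y⌉ + S(B, 𝒫, y)` (`tripleCount_le`).
* The error term of `ChenWeightedSieve` is `N/(⌈z⌉ − 1) ≤ 2N/z = 2N^{7/8}` (`errorTerm_le`, as
  `⌈z⌉ ≥ z ≥ 4`), and `⌈y⌉ < y + 1 ≤ 2y`; the printed (un-halved) terms `2N^{7/8} + N^{1/3}` absorb
  both with room to spare, which gives the strict inequality.

## References

* M. B. Nathanson, *Additive Number Theory: The Classical Bases*, GTM 164, Springer (1996), §10.2,
  Theorem 10.2 (held copy: §10.2 pp. 167–169, the statement of Thm 10.2 on p. 169). [Nathanson1996]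
-/

open Finset
open scoped ArithmeticFunction.Omega

noncomputable section

namespace Literature.NumberTheory.Sieve.Chen

open ChenSieve

/-! ### Elements `n = N − p` of Nathanson's sequence `A` -/

section Elements

variable {N p n : ℕ}

/-- For `p + n = N` with `p ∤ N`, `n ≠ 0` (else `p = N ∣ N`). [folklore] -/
theorem ne_zero_of_goldbach (h : p + n = N) (hpN : ¬p ∣ N) : n ≠ 0 := by
  rintro rfl
  exact hpN (by rw [← h, add_zero])

/-- For `p + n = N` with `p` prime, `n < N` (as `p ≥ 2`). [folklore] -/
theorem lt_of_goldbach (h : p + n = N) (hp : p.Prime) : n < N := by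
  have := hp.two_le
  omega

/-- `(n, N) = 1` for `n = N − p ∈ A` (Nathanson §10.2, held copy p. 168): a prime dividing `n` does
not divide `N`, for otherwise it divides the prime `p ∤ N`.
[cite: Nathanson1996, §10.2 (proof of Thm 10.2)] -/
theorem not_dvd_of_goldbach (h : p + n = N) (hp : p.Prime) (hpN : ¬p ∣ N) {r : ℕ} (hr : r.Prime)
    (hrn : r ∣ n) : ¬r ∣ N := by
  intro hrN
  have h1 : p = N - n := by omega
  have hrp : r ∣ p := by
    rw [h1]
    exact Nat.dvd_sub hrN hrn
  have : r = p := (Nat.prime_dvd_prime_iff_eq hr hp).mp hrp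
  rw [this] at hrN
  exact hpN hrN

/-- Nathanson's sifting condition is roughness: for `n = N − p ∈ A` and an integer level `w`,
"no prime `q < w` with `q ∤ N` divides `n`" iff every prime factor of `n` is `≥ w` (because
`(n, N) = 1`). [cite: Nathanson1996, §10.2 (proof of Thm 10.2)] -/
theorem sift_iff_isRough (h : p + n = N) (hp : p.Prime) (hpN : ¬p ∣ N) (w : ℕ) :
    (∀ q ∈ Nat.primesBelow w, ¬q ∣ N → ¬q ∣ n) ↔ IsRough w n := by
  constructor
  · intro hs r hr
    rw [Nat.mem_primeFactors] at hr
    by_contra hlt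
    exact hs r (Nat.mem_primesBelow.mpr ⟨lt_of_not_ge hlt, hr.1⟩)
      (not_dvd_of_goldbach h hp hpN hr.1 hr.2.1) hr.2.1
  · intro hs q hq _ hqn
    obtain ⟨hqw, hqp⟩ := Nat.mem_primesBelow.mp hq
    have : w ≤ q := hs q (Nat.mem_primeFactors.mpr ⟨hqp, hqn, ne_zero_of_goldbach h hpN⟩)
    omega

end Elements

/-! ### The sieving functions of Thm 10.2 in the abstract vocabulary

Below, `A` is any finite set of natural numbers with Nathanson's membership condition (10.6),
`n ∈ A ↔ n = N − p` for some prime `p ∤ N` (hypothesis `hA`); the pairs `(p, n)`, `p + n = N`,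
`p` prime, `p ∤ N`, are in bijection with `A` by `(p, n) ↦ n`. -/

section Bridge

variable {N : ℕ} {A : Finset ℕ}

/-- Counting in `A` is counting pairs: `#{n ∈ A : P n} = #{(p, n) : p + n = N, p prime, p ∤ N, P n}`
(the bijection `n ↦ (N − n, n)`). [folklore] -/
theorem card_filter_eq_of_goldbach (hA : ∀ n, n ∈ A ↔ ∃ p : ℕ, p.Prime ∧ ¬p ∣ N ∧ p + n = N)
    (P : ℕ → Prop) [DecidablePred P] :
    #(A.filter P) = #{a ∈ antidiagonal N | a.1.Prime ∧ ¬a.1 ∣ N ∧ P a.2} := by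
  refine Finset.card_nbij' (fun n => (N - n, n)) Prod.snd ?_ ?_ ?_ ?_
  · intro n hn
    rw [Finset.mem_coe, Finset.mem_filter] at hn
    obtain ⟨p, hp, hpN, h⟩ := (hA n).mp hn.1
    have hp' : N - n = p := by omega
    rw [Finset.mem_coe, Finset.mem_filter, Finset.HasAntidiagonal.mem_antidiagonal]
    dsimp only
    rw [hp']
    exact ⟨by omega, hp, hpN, hn.2⟩
  · intro a ha
    rw [Finset.mem_coe, Finset.mem_filter, Finset.HasAntidiagonal.mem_antidiagonal] at ha
    rw [Finset.mem_coe, Finset.mem_filter]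
    exact ⟨(hA a.2).mpr ⟨a.1, ha.2.1, ha.2.2.1, ha.1⟩, ha.2.2.2⟩
  · intro n _
    rfl
  · intro a ha
    rw [Finset.mem_coe, Finset.mem_filter, Finset.HasAntidiagonal.mem_antidiagonal] at ha
    refine Prod.ext ?_ rfl
    change N - a.2 = a.1
    omega

/-- `S(A, 𝒫, z) = roughCount A ⌈z⌉`. [cite: Nathanson1996, §10.2 (proof of Thm 10.2)] -/
theorem siftedCount_eq_roughCount (hA : ∀ n, n ∈ A ↔ ∃ p : ℕ, p.Prime ∧ ¬p ∣ N ∧ p + n = N) :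
    siftedCount N (z N) = roughCount A ⌈z N⌉₊ := by
  classical
  rw [roughCount, card_filter_eq_of_goldbach hA, siftedCount]
  congr 1
  ext a
  simp only [Finset.mem_filter, Finset.HasAntidiagonal.mem_antidiagonal]
  constructor
  · rintro ⟨h, hp, hnd, hs⟩
    exact ⟨h, hp, hnd, (sift_iff_isRough h hp hnd _).mp hs⟩
  · rintro ⟨h, hp, hnd, hr⟩
    exact ⟨h, hp, hnd, (sift_iff_isRough h hp hnd _).mpr hr⟩

/-- `S(A_q, 𝒫, z) = roughMultCount A ⌈z⌉ q`. [cite: Nathanson1996, §10.2 (proof of Thm 10.2)] -/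
theorem siftedCountDvd_eq_roughMultCount
    (hA : ∀ n, n ∈ A ↔ ∃ p : ℕ, p.Prime ∧ ¬p ∣ N ∧ p + n = N) (q : ℕ) :
    siftedCountDvd N q (z N) = roughMultCount A ⌈z N⌉₊ q := by
  classical
  rw [roughMultCount, card_filter_eq_of_goldbach hA, siftedCountDvd]
  congr 1
  ext a
  simp only [Finset.mem_filter, Finset.HasAntidiagonal.mem_antidiagonal]
  constructor
  · rintro ⟨h, hp, hnd, hq, hs⟩
    exact ⟨h, hp, hnd, hq, (sift_iff_isRough h hp hnd _).mp hs⟩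
  · rintro ⟨h, hp, hnd, hq, hr⟩
    exact ⟨h, hp, hnd, hq, (sift_iff_isRough h hp hnd _).mpr hr⟩

/-- The primes `q` with `z ≤ q < y` are the primes of the integer interval `[⌈z⌉, ⌈y⌉)`.
[folklore] -/
theorem midPrimes_eq_primesIco (N : ℕ) :
    midPrimes (z N) (y N) = primesIco ⌈z N⌉₊ ⌈y N⌉₊ := by
  ext q
  rw [midPrimes, Finset.mem_filter, Nat.mem_primesBelow, mem_primesIco, Nat.ceil_le]
  tauto

/-- `#{n ∈ A : Ω(n) ≤ 2} ≤ r(N)`: for `p + n = N` with `N` even, `p` prime, `p ∤ N`, the prime `p`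
is odd (`p ∤ N` excludes `p = 2`). [cite: Nathanson1996, §10.2 (proof of Thm 10.2)] -/
theorem almostPrimeTwoCount_le_repCount
    (hA : ∀ n, n ∈ A ↔ ∃ p : ℕ, p.Prime ∧ ¬p ∣ N ∧ p + n = N) (hN : Even N) :
    almostPrimeTwoCount A ≤ repCount N := by
  classical
  rw [almostPrimeTwoCount, card_filter_eq_of_goldbach hA, repCount]
  refine Finset.card_le_card fun a ha => ?_
  rw [Finset.mem_filter] at ha ⊢
  obtain ⟨hmem, hp, hnd, h2⟩ := ha
  refine ⟨hmem, hp, ?_, h2⟩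
  refine hp.odd_of_ne_two fun h2' => hnd ?_
  rw [h2']
  exact even_iff_two_dvd.mp hN

/-- **The third weight and the set `B`** (Nathanson §10.2, held copy p. 169): the elements
`n = p₁p₂p₃ ∈ A`, `⌈z⌉ ≤ p₁ < ⌈y⌉ ≤ p₂ ≤ p₃`, are `N − p` with `p` prime; those with `p < y` are
fewer than `⌈y⌉`, and those with `p ≥ y` have `p ∈ B` with no prime factor `< y`. Hence
`T(A; ⌈z⌉, ⌈y⌉) ≤ ⌈y⌉ + S(B, 𝒫, y)`. [cite: Nathanson1996, §10.2 (proof of Thm 10.2)] -/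
theorem tripleCount_le (hA : ∀ n, n ∈ A ↔ ∃ p : ℕ, p.Prime ∧ ¬p ∣ N ∧ p + n = N) :
    tripleCount A ⌈z N⌉₊ ⌈y N⌉₊ ≤ ⌈y N⌉₊ + switchedSiftedCount N (z N) (y N) := by
  classical
  rw [tripleCount, card_filter_eq_of_goldbach hA]
  set y' := ⌈y N⌉₊ with hy'
  set T := (antidiagonal N).filter fun a => a.1.Prime ∧ ¬a.1 ∣ N ∧ IsChenTriple ⌈z N⌉₊ y' a.2
    with hT
  have hinj : Set.InjOn Prod.fst (T : Set (ℕ × ℕ)) := by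
    intro a ha b hb h
    have ha' := (Finset.mem_filter.mp (Finset.mem_coe.mp ha)).1
    have hb' := (Finset.mem_filter.mp (Finset.mem_coe.mp hb)).1
    exact (Finset.HasAntidiagonal.antidiagonal_congr ha' hb').mpr h
  have hsplit : #(T.filter fun a => a.1 < y') + #(T.filter fun a => ¬a.1 < y') = #T :=
    Finset.card_filter_add_card_filter_not _
  -- the primes `p < y`
  have h1 : #(T.filter fun a => a.1 < y') ≤ y' := by
    calc #(T.filter fun a => a.1 < y')
        = #((T.filter fun a => a.1 < y').image Prod.fst) :=
          (Finset.card_image_of_injOn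
            (hinj.mono (Finset.coe_subset.mpr (Finset.filter_subset _ _)))).symm
      _ ≤ #(Finset.range y') := by
          refine Finset.card_le_card (Finset.image_subset_iff.mpr fun a ha => ?_)
          exact Finset.mem_range.mpr (Finset.mem_filter.mp ha).2
      _ = y' := Finset.card_range y'
  -- the primes `p ≥ y` lie in `B` and survive the sieve up to `y`
  have h2 : #(T.filter fun a => ¬a.1 < y') ≤ switchedSiftedCount N (z N) (y N) := by
    rw [switchedSiftedCount]
    calc #(T.filter fun a => ¬a.1 < y')
        = #((T.filter fun a => ¬a.1 < y').image Prod.fst) :=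
          (Finset.card_image_of_injOn
            (hinj.mono (Finset.coe_subset.mpr (Finset.filter_subset _ _)))).symm
      _ ≤ _ := Finset.card_le_card ?_
    intro p hp
    rw [Finset.mem_image] at hp
    obtain ⟨a, ha, rfl⟩ := hp
    rw [Finset.mem_filter] at ha
    obtain ⟨haT, hge⟩ := ha
    rw [hT, Finset.mem_filter, Finset.HasAntidiagonal.mem_antidiagonal] at haT
    obtain ⟨hsum, hp, hnd, p₁, p₂, p₃, hp₁, hp₂, hp₃, hz1, h1y, hy2, h23, heq⟩ := haT
    have hn0 : a.2 ≠ 0 := ne_zero_of_goldbach hsum hnd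
    have hnN : a.2 < N := lt_of_goldbach hsum hp
    have hle : ∀ r : ℕ, r ∣ p₁ * p₂ * p₃ → r < N := fun r hr =>
      lt_of_le_of_lt (Nat.le_of_dvd (Nat.pos_of_ne_zero hn0) (by rw [heq]; exact hr)) hnN
    rw [Finset.mem_filter]
    refine ⟨?_, ?_⟩
    · rw [switchedSet, Finset.mem_filter, Finset.mem_range]
      refine ⟨by omega, p₁, Nat.mem_primesBelow.mpr ⟨hle p₁ ?_, hp₁⟩,
        p₂, Nat.mem_primesBelow.mpr ⟨hle p₂ ?_, hp₂⟩, p₃, Nat.mem_primesBelow.mpr ⟨hle p₃ ?_, hp₃⟩,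
        Nat.ceil_le.mp hz1, Nat.lt_ceil.mp h1y, Nat.ceil_le.mp hy2, h23, by omega, ?_, by omega⟩
      · exact (dvd_mul_right p₁ p₂).mul_right p₃
      · exact (dvd_mul_left p₂ p₁).mul_right p₃
      · exact dvd_mul_left p₃ (p₁ * p₂)
      · rw [← heq]
        exact Nat.coprime_of_dvd fun k hk hkn => not_dvd_of_goldbach hsum hp hnd hk hkn
    · intro r hr _ hrp
      obtain ⟨hry, hrprime⟩ := Nat.mem_primesBelow.mp hr
      have : r = a.1 := (Nat.prime_dvd_prime_iff_eq hrprime hp).mp hrp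
      omega
  omega

end Bridge

/-! ### The parameters `⌈z⌉`, `⌈y⌉` and the error terms -/

/-- `z = N^{1/8} ≥ 4` for `N ≥ 4⁸` (Nathanson §10.2, held copy p. 167: "Then `z ≥ 4`").
[cite: Nathanson1996, §10.2] -/
theorem four_le_z {N : ℕ} (hN : 4 ^ 8 ≤ N) : (4 : ℝ) ≤ z N := by
  rw [z]
  have h4 : (4 : ℝ) = ((4 : ℝ) ^ (8 : ℕ)) ^ (1 / 8 : ℝ) := by
    rw [show (1 / 8 : ℝ) = ((8 : ℕ) : ℝ)⁻¹ by norm_num,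
      Real.pow_rpow_inv_natCast (by norm_num) (by norm_num)]
  rw [h4]
  exact Real.rpow_le_rpow (by positivity) (by exact_mod_cast hN) (by norm_num)

/-- `⌈z⌉ ≥ 4` for `N ≥ 4⁸`. [folklore] -/
theorem four_le_ceil_z {N : ℕ} (hN : 4 ^ 8 ≤ N) : 4 ≤ ⌈z N⌉₊ := by
  have := (four_le_z hN).trans (Nat.le_ceil (z N))
  exact_mod_cast this

/-- `y = N^{1/3} ≥ 1` for `N ≥ 1`. [folklore] -/
theorem one_le_y {N : ℕ} (hN : 1 ≤ N) : (1 : ℝ) ≤ y N :=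
  Real.one_le_rpow (by exact_mod_cast hN) (by norm_num)

/-- `N ≤ ⌈y⌉³` (`y³ = N`). [folklore] -/
theorem le_ceil_y_pow (N : ℕ) : N ≤ ⌈y N⌉₊ ^ 3 := by
  have h0 : (0 : ℝ) ≤ N := N.cast_nonneg
  have h1 : ((N : ℝ) ^ (1 / 3 : ℝ)) ^ (3 : ℕ) = N := by
    rw [show (1 / 3 : ℝ) = ((3 : ℕ) : ℝ)⁻¹ by norm_num, Real.rpow_inv_natCast_pow h0 three_ne_zero]
  have h2 : (N : ℝ) ≤ ((⌈y N⌉₊ : ℕ) : ℝ) ^ 3 :=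
    calc (N : ℝ) = ((N : ℝ) ^ (1 / 3 : ℝ)) ^ (3 : ℕ) := h1.symm
      _ ≤ ((⌈y N⌉₊ : ℕ) : ℝ) ^ 3 := pow_le_pow_left₀ (Real.rpow_nonneg h0 _) (Nat.le_ceil (y N)) 3
  exact_mod_cast h2

/-- The error term of `ChenWeightedSieve` against Nathanson's: `N/(⌈z⌉ − 1) ≤ 2N/z = 2N^{7/8}` for
`N ≥ 4⁸` (held copy p. 169: `N/(z − 2) ≤ 2N/z` as `z ≥ 4`). [cite: Nathanson1996, §10.2 (proof of Thm 10.2)] -/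
theorem errorTerm_le {N : ℕ} (hN : 4 ^ 8 ≤ N) :
    (N : ℝ) / ((⌈z N⌉₊ : ℝ) - 1) ≤ 2 * (N : ℝ) ^ (7 / 8 : ℝ) := by
  have hz4 : (4 : ℝ) ≤ z N := four_le_z hN
  have hzc : z N ≤ ⌈z N⌉₊ := Nat.le_ceil _
  have hN0 : (0 : ℝ) < N := by
    have : ((4 ^ 8 : ℕ) : ℝ) ≤ N := by exact_mod_cast hN
    have h' : (0 : ℝ) < ((4 ^ 8 : ℕ) : ℝ) := by positivity
    linarith
  have h78 : (N : ℝ) ^ (7 / 8 : ℝ) = N / z N := by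
    rw [z, show (7 / 8 : ℝ) = 1 - 1 / 8 by norm_num, Real.rpow_sub hN0, Real.rpow_one]
  rw [h78, div_le_iff₀ (by linarith)]
  have hz0 : (0 : ℝ) < z N := by linarith
  rw [show 2 * ((N : ℝ) / z N) * ((⌈z N⌉₊ : ℝ) - 1) = N * ((2 * (⌈z N⌉₊ : ℝ) - 2) / z N) by ring]
  refine le_mul_of_one_le_right hN0.le ?_
  rw [le_div_iff₀ hz0]
  linarith

/-! ### The discharge -/

/-- **Nathanson's Theorem 10.2, proved** (`Literature.NumberTheory.Sieve.Chen.chen_weighted_sieve_inequality`):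
for every even `N ≥ 4⁸`, with `z = N^{1/8}`, `y = N^{1/3}`,
`r(N) > S(A, 𝒫, z) − ½ ∑_{z ≤ q < y} S(A_q, 𝒫, z) − ½ S(B, 𝒫, y) − 2N^{7/8} − N^{1/3}`.
Proof: the abstract inequality `ChenSieve.weightedSieve` (Chen's weights, pointwise) for
`A = {N − p}` with the parameters `⌈z⌉, ⌈y⌉`, the identifications `siftedCount_eq_roughCount`,
`siftedCountDvd_eq_roughMultCount`, `midPrimes_eq_primesIco`, the bounds `tripleCount_le`
(`T ≤ ⌈y⌉ + S(B, 𝒫, y)`), `ChenSieve.squareCount_le` + `errorTerm_le` (`E ≤ N/(⌈z⌉ − 1) ≤ 2N^{7/8}`),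
`almostPrimeTwoCount_le_repCount`, and `⌈y⌉ < y + 1 ≤ 2y`. [cite: Nathanson1996, Thm 10.2] -/
theorem chen_weighted_sieve_inequality_holds : chen_weighted_sieve_inequality := by
  intro N hN h48
  classical
  -- Nathanson's `A = {N − p : p ≤ N, p prime, p ∤ N}` as a finite set of naturals
  set A : Finset ℕ := ({a ∈ antidiagonal N | a.1.Prime ∧ ¬a.1 ∣ N}).image Prod.snd with hAdef
  have hA : ∀ n, n ∈ A ↔ ∃ p : ℕ, p.Prime ∧ ¬p ∣ N ∧ p + n = N := by
    intro n
    simp only [hAdef, Finset.mem_image, Finset.mem_filter, Finset.HasAntidiagonal.mem_antidiagonal,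
      Prod.exists]
    constructor
    · rintro ⟨p, m, ⟨h, hp, hnd⟩, rfl⟩
      exact ⟨p, hp, hnd, h⟩
    · rintro ⟨p, hp, hnd, h⟩
      exact ⟨p, n, ⟨h, hp, hnd⟩, rfl⟩
  set z' := ⌈z N⌉₊ with hz'
  set y' := ⌈y N⌉₊ with hy'
  have hmem : ∀ n ∈ A, n ≠ 0 ∧ n < N := by
    intro n hn
    obtain ⟨p, hp, hnd, hsum⟩ := (hA n).mp hn
    exact ⟨ne_zero_of_goldbach hsum hnd, lt_of_goldbach hsum hp⟩
  have hAmem : ∀ n ∈ A, n ≠ 0 ∧ n < y' ^ 3 := fun n hn =>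
    ⟨(hmem n hn).1, lt_of_lt_of_le (hmem n hn).2 (le_ceil_y_pow N)⟩
  have hAIoc : A ⊆ Finset.Ioc 0 N := fun n hn =>
    Finset.mem_Ioc.mpr ⟨Nat.pos_of_ne_zero (hmem n hn).1, (hmem n hn).2.le⟩
  have hz4 : 4 ≤ z' := four_le_ceil_z h48
  have hW := weightedSieve (A := A) (z := z') (y := y') hAmem
  have hE := squareCount_le (A := A) (y := y') (M := N) hAIoc (le_trans (by norm_num) hz4)
  have hErr := errorTerm_le h48
  have hT : (tripleCount A z' y' : ℝ) ≤ y' + switchedSiftedCount N (z N) (y N) := by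
    exact_mod_cast tripleCount_le hA
  have hR : (almostPrimeTwoCount A : ℝ) ≤ repCount N := by
    exact_mod_cast almostPrimeTwoCount_le_repCount hA hN
  have hS : (siftedCount N (z N) : ℝ) = roughCount A z' := by
    exact_mod_cast siftedCount_eq_roughCount hA
  have hSum : ∑ q ∈ midPrimes (z N) (y N), (siftedCountDvd N q (z N) : ℝ) =
      ∑ q ∈ primesIco z' y', (roughMultCount A z' q : ℝ) := by
    rw [midPrimes_eq_primesIco]
    exact Finset.sum_congr rfl fun q _ => by rw [siftedCountDvd_eq_roughMultCount hA]
  have hy1 : (1 : ℝ) ≤ y N := one_le_y (le_trans (by norm_num) h48)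
  have hyc : (y' : ℝ) < y N + 1 := Nat.ceil_lt_add_one (by linarith)
  rw [hS, hSum, show (N : ℝ) ^ (1 / 3 : ℝ) = y N from rfl]
  linarith

end Literature.NumberTheory.Sieve.Chen
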